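import Literature.AlgebraicGeometry.Resolution.AlterationsFibresConnected
import Literature.AlgebraicGeometry.Resolution.ProjectiveSpaceRegular
import Literature.AlgebraicGeometry.Resolution.SmoothStalksRegular
import Literature.AlgebraicGeometry.Morphisms.SmoothOfFlatFibre
import Literature.AlgebraicGeometry.Dimension.FibreLocalRingDimension
import Literature.AlgebraicGeometry.Motives.FiberStalk
import Literature.AlgebraicGeometry.Motives.VarietiesDimensionProofs
import Literature.AlgebraicGeometry.Motives.VarietiesProjectiveSpaceProofs
import Literature.RingTheory.Flat.RegularFibreFlat
import HarnessLib

/-!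
# De Jong 1996, 4.12 with 2.8: `f` is smooth over a non-empty open of `ℙ^{d-1}` — proof

Topic: `Literature/AlgebraicGeometry/Resolution`. This file DISCHARGES the named fact
`DeJong1996SmoothOverOpen` of `AlterationsLemma411.lean` (de Jong 1996, 4.12: "We remark that
`f`, having one nonsingular fibre and `ℙ^{d-1}` being nonsingular imply that `f` is smooth over a
nonempty open part of `ℙ^{d-1}`, see 2.8"), along the printed route:

* **2.8 at a point of the smooth fibre.** For `x ∈ X'` over the point `y ∈ ℙ^d` with smooth
  fibre, put `A = 𝒪_{ℙ^d, y}` (a regular local ring, `isRegular_projectiveSpace`) and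
  `B = 𝒪_{X', x}`. The fibre ring `B/𝔪_A B` is the local ring of the fibre `X'_y` at `x`
  (`Literature.AlgebraicGeometry.Motives.nonempty_stalkFiber_ringEquiv_asFiber`), regular since
  `X'_y` is smooth over `κ(y)` (`isRegularLocalRing_stalk_of_smooth_of_field`, Stacks 056S), and
  `dim A + dim B/𝔪_A B ≤ dim B` because `X'` is an integral variety of dimension `d + 1` over
  `k` whose fibres over `ℙ^d` are equidimensional of dimension `1`
  (`Literature.AlgebraicGeometry.Dimension.ringKrullDim_stalk_add_ringKrullDim_stalk_fiber_le`).
  Hence `B` is flat over `A` — Matsumura's Thm. 23.1 in its regular-fibre form,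
  `Literature.RingTheory.Flat.flat_of_isRegularLocalRing_of_isRegularLocalRing_fiber`, which is
  the algebra of 2.8 — and so `x` lies in the smooth locus of `f` (flat with smooth fibre,
  EGA IV₄ 17.5.1, `Literature.AlgebraicGeometry.Morphisms.mem_smoothLocus_of_flat_stalkMap_of_smooth_fiber`).
* **Spreading out.** `f` is proper, hence closed, so `V = ℙ^d ∖ f(X' ∖ sm(f))` is an open
  neighbourhood of `y` with `f⁻¹(V) ⊆ sm(f)`
  (`Literature.AlgebraicGeometry.Morphisms.exists_smooth_morphismRestrict_of_forall_mem_smoothLocus`).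

## Sources

* A. J. de Jong, *Smoothness, semi-stability and alterations*, Publ. Math. IHÉS 83 (1996) 51–93:
  2.8 (p. 55), 4.12 (p. 68). [DeJong1996]
* H. Matsumura, *Commutative Ring Theory* (1986), Thm. 23.1. [Matsumura1987]
* A. Grothendieck, EGA IV₄ (1967), Thm. 17.5.1; The Stacks Project, Tags 01V8, 056S.
-/

noncomputable section

open CategoryTheory CategoryTheory.Limits AlgebraicGeometry TopologicalSpace IsLocalRing

namespace Literature.AlgebraicGeometry.Resolution

universe u

open Literature.AlgebraicGeometry.Motives (projectiveSpace)

namespace DeJong1996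

variable {k : Type u} [Field k] {X : Scheme.{u}} {fX : X ⟶ Spec (.of k)} {Z : Set X} {d : ℕ}
  {X' : Scheme.{u}} {φ : X' ⟶ X} {f : X' ⟶ (projectiveSpace d k).left}

/-- **de Jong 1996, 2.8 in the situation of 4.12: `f` is flat at every point of a smooth
fibre.** For `(X, Z)` a normal projective pair of dimension `d + 1`, `φ : X' → X` and
`f : X' → ℙ^d_k` as in Lemma 4.11, and `x ∈ X'` such that the fibre of `f` over `y = f x` is
smooth over `κ(y)`, the local homomorphism `𝒪_{ℙ^d, y} → 𝒪_{X', x}` is flat: `𝒪_{ℙ^d, y}` is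
regular, the fibre ring `𝒪_{X', x}/𝔪_y 𝒪_{X', x} = 𝒪_{X'_y, x}` is regular, and
`dim 𝒪_{ℙ^d, y} + dim 𝒪_{X'_y, x} ≤ dim 𝒪_{X', x}` (`X'` is a variety of dimension `d + 1` with
fibres of pure dimension `1` over `ℙ^d`), so that Matsumura's Thm. 23.1 (regular-fibre form)
applies. [cite: DeJong1996, 2.8 and 4.12, pp. 55 and 68] -/
theorem IsLemma411Fibration.flat_stalkMap_of_smooth_fiber (hP : NormalProjectivePair fX Z)
    (hd : topologicalKrullDim X = (d + 1 : ℕ)) (hF : IsLemma411Fibration fX Z d φ f) {x : X'}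
    (hx : Smooth (f.fiberToSpecResidueField (f x))) : (f.stalkMap x).hom.Flat := by
  haveI := hP.isIntegral
  haveI := hP.isProper
  have hφ : IsAlteration φ := hF.isAlteration hP hd
  haveI := hφ.isIntegral
  haveI := hφ.isProper
  haveI : IsProper f := hF.isProper hP hd
  haveI : IsProper (projectiveSpace d k).hom := Motives.isProper_projectiveSpace d k
  haveI := isIntegral_projectiveSpace d k
  haveI : IsLocallyNoetherian X' := LocallyOfFiniteType.isLocallyNoetherian (φ ≫ fX)
  -- the rings
  set A := (projectiveSpace d k).left.presheaf.stalk (f x) with hA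
  set B := X'.presheaf.stalk x with hB
  letI : Algebra A B := (f.stalkMap x).hom.toAlgebra
  haveI : IsLocalHom (algebraMap A B) := inferInstanceAs (IsLocalHom (f.stalkMap x).hom)
  haveI : IsRegularLocalRing A := isRegular_projectiveSpace d k (f x)
  haveI : IsNoetherianRing B := inferInstanceAs (IsNoetherianRing (X'.presheaf.stalk x))
  -- the fibre ring is the (regular) local ring of the smooth fibre
  obtain ⟨e₀⟩ := Literature.AlgebraicGeometry.Motives.nonempty_stalkFiber_ringEquiv_asFiber f x
  have hregF : IsRegularLocalRing ((f.fiber (f x)).presheaf.stalk (f.asFiber x)) :=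
    @isRegularLocalRing_stalk_of_smooth_of_field _ _ _ (f.fiberToSpecResidueField (f x)) hx
      (f.asFiber x)
  haveI := hregF
  have hF' : IsRegularLocalRing (B ⧸ (maximalIdeal A).map (algebraMap A B)) :=
    IsRegularLocalRing.of_ringEquiv e₀
  -- dimensions: `dim A + dim B/𝔪_A B ≤ dim B`
  have hdimX' : topologicalKrullDim X' = (d + 1 : ℕ) := by rw [hφ.topologicalKrullDim_eq fX, hd]
  have hdimP : topologicalKrullDim ↥(projectiveSpace d k).left ≤ d := by
    haveI := (Motives.isSmoothProjective_projectiveSpace_holds k d).smoothOfRelativeDimension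
    exact (Motives.topologicalKrullDim_eq_of_smoothOfRelativeDimension
      (projectiveSpace d k).hom d).le
  haveI : LocallyOfFiniteType f := inferInstance
  have hle := Literature.AlgebraicGeometry.Dimension.ringKrullDim_stalk_add_ringKrullDim_stalk_fiber_le
    (φ ≫ fX) (projectiveSpace d k).hom f (by rw [hF.comp_hom]) (n := d + 1) (m := d) (r := 1)
    rfl hdimX' hdimP x (fun C hC => (hF.topologicalKrullDim_eq_one (f x) C hC).le)
  have hdimF : ringKrullDim ((f.fiber (f x)).presheaf.stalk (f.asFiber x)) =
      ringKrullDim (B ⧸ (maximalIdeal A).map (algebraMap A B)) :=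
    ringKrullDim_eq_of_ringEquiv e₀
  have hdim : ringKrullDim A + ringKrullDim (B ⧸ (maximalIdeal A).map (algebraMap A B)) ≤
      ringKrullDim B := by
    rw [← hdimF]
    exact hle
  -- Matsumura 23.1 (regular fibre) = de Jong 2.8
  have hflat : Module.Flat A B :=
    Literature.RingTheory.Flat.flat_of_isRegularLocalRing_of_isRegularLocalRing_fiber hF' hdim
  exact hflat

/-- **Every point of a smooth fibre of `f` lies in the smooth locus of `f`** (de Jong 1996,
4.12 with 2.8): flat at the point (`flat_stalkMap_of_smooth_fiber`) with smooth fibre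
(EGA IV₄ 17.5.1). [cite: DeJong1996, 2.8 and 4.12, pp. 55 and 68] -/
theorem IsLemma411Fibration.mem_smoothLocus_of_smooth_fiber (hP : NormalProjectivePair fX Z)
    (hd : topologicalKrullDim X = (d + 1 : ℕ)) (hF : IsLemma411Fibration fX Z d φ f) {x : X'}
    (hx : Smooth (f.fiberToSpecResidueField (f x))) :
    x ∈ @Scheme.Hom.smoothLocus _ _ f hF.locallyOfFinitePresentation := by
  haveI := hF.locallyOfFinitePresentation
  exact Literature.AlgebraicGeometry.Morphisms.mem_smoothLocus_of_flat_stalkMap_of_smooth_fiber f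
    (hF.flat_stalkMap_of_smooth_fiber hP hd hx) hx

end DeJong1996

/-- **`DeJong1996SmoothOverOpen` holds** (de Jong 1996, 4.12: "`f`, having one nonsingular fibre
and `ℙ^{d-1}` being nonsingular imply that `f` is smooth over a nonempty open part of
`ℙ^{d-1}`, see 2.8"): every point of the smooth fibre over `y` lies in the smooth locus of `f`
(`DeJong1996.IsLemma411Fibration.mem_smoothLocus_of_smooth_fiber`), and `f` is proper, hence
closed, so `f` is smooth over the open neighbourhood `ℙ^d ∖ f(X' ∖ sm(f))` of `y`.
[cite: DeJong1996, 4.12 and 2.8, pp. 68 and 55] -/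
theorem DeJong1996SmoothOverOpen_holds : DeJong1996SmoothOverOpen.{u} := by
  intro k _ _ X fX Z d X' φ f hP hd hF hy
  obtain ⟨y, hy⟩ := hy
  haveI := hF.locallyOfFinitePresentation
  haveI : IsProper f := hF.isProper hP hd
  have key : ∀ x : X', f x = y → x ∈ f.smoothLocus := by
    rintro x rfl
    exact hF.mem_smoothLocus_of_smooth_fiber hP hd hy
  obtain ⟨V, hyV, hV⟩ :=
    Literature.AlgebraicGeometry.Morphisms.exists_smooth_morphismRestrict_of_forall_mem_smoothLocus
      f key
  exact ⟨V, ⟨y, hyV⟩, hV⟩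

end Literature.AlgebraicGeometry.Resolution

end
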